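import Summits.BirchSwinnertonDyer.BirchSwinnertonDyer.Theorems.PrintCf2SplitBadTwoRestrictedSelmerRelaxationLift
import Summits.BirchSwinnertonDyer.BirchSwinnertonDyer.Theorems.PrintCf2SplitBadTwoRestrictedSelmerBottomSelmerToTrueSelmer
import Literature.NumberTheory.EllipticCurves.SelmerRestrictionCorank
import HarnessLib

/-!
# Crux `PrintCf2.SplitBadTwoRankOneOfFacts` (stmt-BirchSwinnertonDyer-20368), road α v10.4/10.5, (BF) «`Ш` finite ⟹ `𝔖_{v̄}(K, W*)` finite»,
# part 2 (generic core): `𝔖_{v̄}(K, W*)` IS FINITE from a uniform relaxation exponent, `Ш(E_K)[p^∞]` finite, and the finiteness of the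
# strict-at-`v̄` Mordell–Weil classes of the summand

Cell `bsd-print-cf2`, EXTRA WIDTH seat `bsd-line-cf2-p1-w4` g10 (prover-bsd-line-cf2-p1-w4-g10-0); `--supports stmt-BirchSwinnertonDyer-20368`
(helper, Theses-free). HONEST FRAMING: nothing here closes the crux or a registered stub; BSD is not proved by any of this; no summit
statement is proved by this seat. No definition, no named fact, no `sorry`. LEAD ASSIGN 2026-08-29T00:16:10Z (1).

WHAT (generic `V/K` elliptic over a TOTALLY COMPLEX number field, prime `p` with exactly two places `v ≠ v̄` above it, complementary CM-type
summands `W* = E[𝔮_r^∞]`, `W*′ = E[𝔮_{r′}^∞]` with equivariant projectors `e, e′`, an equivariant endomorphism `f₀` of `E(K̄)` with local points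
maps acting as `r`/`r′` on the summands — the data of -w7 g2's `resH1Hom_subtype_proj_mem_map_resSubgroup_selmer`):
**`finite_restrictedSelmerBase_of_uniform_of_finite`**: `𝔖 := 𝔖_{v̄}(K, W*)` (Agboola's restricted group: strict at `v̄`, nothing at `v`, zero away
from `p`) is FINITE as soon as
 (U) some `N ≠ 0` satisfies `N • kummerOutside V (p^{k+1}) {v} ⊆ Sel^{(p^{k+1})}(V/K)` for every `k` (part 1,
     `RelaxationLift.exists_uniform_nsmul_mem_selmerGroup_of_apply_ne_zero`: Tate–Poitou at finite level, rank ≥ 1 at `v`),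
 (Ш) `Ш(E_K/K)[p^∞]` is finite, and
 (Q) the Mordell–Weil classes of the summand strict at `v̄`, `j_*⁻¹(res_⊤ range κ) ⊓ ker res_{D_{v̄}}`, form a finite group.
PROOF. (1) `N • 𝔖 ⊆ 𝔖_Sel := 𝔖 ⊓ j_*⁻¹(res_⊤ Sel_{p^∞}(E/K))`: a class `y ∈ 𝔖` is `p`-primary, hence the level lift of some `x ∈ kummerOutside`
(part 1 `exists_mem_kummerOutside_levelLift_eq`); `N • x` is Selmer, so `ι_{k,*}(N • x) ∈ Sel_{p^∞}` (`map_primaryInclusion_mem_selmerGroupPInfty`,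
functoriality `(E[p^∞] ↪ E)_* ∘ H¹(ι_k) = (E[p^k] ↪ E)_*`) and `j_*(N • y) = j_* e_* res_⊤(ι_{k,*}(N • x)) ∈ res_⊤ Sel_{p^∞}` by -w7 g2's
«the `W*`-component of a Selmer class is Selmer». (2) `𝔖_Sel` is finite: -w7 g2's `f_S : S → H¹(K, E)` (`…BottomShaBridge`) has kernel `S ⊓ Q`
(`ker_shaMap_eq`) `≤` the group of (Q), and range inside `Ш(E_K/K)[p^∞]`. (3) `𝔖[N]` is finite: its classes are killed by `p^{v_p(N)+1}`, hence
are level lifts from the FINITE group `kummerOutside V (p^{v_p(N)+1}) {v}` (finite index over the finite `Sel`, bsd-cn100's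
`relIndex_selmerGroup_kummerOutside_mul_addOrderOf_le` + Silverman X.4.2(b) `finite_selmerGroup_holds`). (4) `#𝔖 = #𝔖[N] · #(N • 𝔖)`.
presearch: Agboola 2007 §6 Props. 6.10–6.12 (finiteness of `𝔖_{𝔭*}(K, W*)` at `r = 1`), Coates 1983 / Perrin-Riou 1984 (classical `p > 2`) → here
assembled from tree theorems; no new fact. beyond-print theorem: no.

References: [Agboola2007] §3, §6 Props. 6.10–6.12; [GreenbergLNM1716] §2 p. 63, §5 proof of Prop. 5.8; [MilneADT2006] I Thm. 4.10(b);
[SilvermanAEC2009] Thm. X.4.2(b), Prop. VII.6.3.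
-/

noncomputable section

open scoped Classical

set_option linter.dupNamespace false
set_option autoImplicit false

open CategoryTheory Function Field NumberField IsDedekindDomain WeierstrassCurve
open Literature.NumberTheory.EllipticCurves Literature.NumberTheory.EllipticCurves.GreenbergSelmer
open Literature.NumberTheory.EllipticCurves.Agboola2007
open Literature.NumberTheory.EllipticCurves.ResKernel
open Literature.NumberTheory.GaloisRepresentations
open Literature.NumberTheory.GaloisRepresentations.DiscreteGaloisModule (SelmerStructure)
open Literature.NumberTheory.GaloisCohomology
open scoped ContRepresentation
open Summit.BirchSwinnertonDyer.Rank1Residual.X11b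
open Summit.BirchSwinnertonDyer.Rank1Residual.X11b.LocBridge
open Summit.BirchSwinnertonDyer.Rank1Residual.X11b.Levels
open Summit.BirchSwinnertonDyer.BirchSwinnertonDyer.Theorems.PrintCf2.RestrictedSelmerPair
open Summit.BirchSwinnertonDyer.BirchSwinnertonDyer.Theorems.CongruentShaFreeCutSelmerRelaxationUniform

universe u

namespace Summit.BirchSwinnertonDyer.BirchSwinnertonDyer.Theorems.PrintCf2.RelaxationLift

/-! ## §1. `ι_{k,*} Sel^{(p^k)} ⊆ Sel_{p^∞}` and finiteness of `kummerOutside` -/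

section Levels

variable {K : Type} [Field K] (V : WeierstrassCurve K) (p k : ℕ)

/-- `(E[p^∞] ↪ E)_* ∘ H¹(ι_k) = (E[p^k] ↪ E)_*` on `H¹(K, ·)` (functoriality of `H¹` in the coefficients; bsd-cn100's
`primaryH1ToH1_comp_map_primaryInclusion`, bsd-kato's `primaryH1ToH1_map_primaryInclusion_eq`). [cite: GreenbergLNM1716, §5 proof of Prop. 5.8] -/
theorem primaryH1ToH1_map_primaryInclusion (c : galoisCohomology (V.torsionGaloisModule ((p ^ k : ℕ) : ℤ)) 1) :
    primaryH1ToH1 V p (galoisCohomology.map (primaryInclusion V p k) 1 c) = torsionH1ToH1 V ((p ^ k : ℕ) : ℤ) c := by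
  have h : (primaryH1ToH1 V p).comp
      (resH1Hom (ContinuousMonoidHom.id (Field.absoluteGaloisGroup K))
        (AddSubgroup.inclusion (geomTorsion_pow_le_geomPrimaryTorsion V p k)) (fun _ _ ↦ rfl) :
        galH1Torsion V ((p ^ k : ℕ) : ℤ) →+ galH1Primary V p) = torsionH1ToH1 V ((p ^ k : ℕ) : ℤ) := by
    rw [primaryH1ToH1, resH1Hom_comp, torsionH1ToH1_eq_resH1Hom]
    exact resH1Hom_congr rfl (AddMonoidHom.ext fun _ ↦ rfl) _ _
  exact DFunLike.congr_fun h c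

variable [NumberField K]

/-- **`ι_{k,*} Sel^{(p^k)}(E/K) ⊆ Sel_{p^∞}(E/K)`**: both Selmer groups are the preimages of `Ш(E_K/K)` (`selmerGroup_eq_comap_sha`,
`selmerGroupPInfty_eq_comap_sha`) and `(E[p^∞] ↪ E)_* ∘ H¹(ι_k) = (E[p^k] ↪ E)_*`. [cite: GreenbergLNM1716, §2 p. 63] -/
theorem map_primaryInclusion_mem_selmerGroupPInfty {c : galoisCohomology (V.torsionGaloisModule ((p ^ k : ℕ) : ℤ)) 1}
    (hc : c ∈ selmerGroup V ((p ^ k : ℕ) : ℤ)) :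
    galoisCohomology.map (primaryInclusion V p k) 1 c ∈ V.selmerGroupPInfty p := by
  rw [V.selmerGroupPInfty_eq_comap_sha p]
  change V.primaryH1ToH1 p (galoisCohomology.map (primaryInclusion V p k) 1 c) ∈ V.sha
  rw [primaryH1ToH1_map_primaryInclusion]
  rw [V.selmerGroup_eq_comap_sha] at hc
  exact hc

variable [V.IsElliptic] [Fact p.Prime]

/-- **`kummerOutside V (p^{k+1}) {v}` is finite**: it contains the finite `Sel^{(p^{k+1})}` (Silverman X.4.2(b), `finite_selmerGroup_holds`) with
finite index (`relIndex_selmerGroup_kummerOutside_mul_addOrderOf_le`, Tate–Poitou). [cite: SilvermanAEC2009, Thm. X.4.2(b)]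
[cite: JetchevSkinnerWan2017, Prop. 3.2.1] -/
theorem finite_kummerOutside (v : HeightOneSpectrum (𝓞 K)) :
    Finite (kummerOutside V (p ^ (k + 1)) {Sum.inr v}) := by
  have hp : p.Prime := Fact.out
  haveI : NeZero (p ^ (k + 1)) := ⟨pow_ne_zero _ hp.ne_zero⟩
  have hn0 : ((p ^ (k + 1) : ℕ) : ℤ) ≠ 0 := Int.natCast_ne_zero.mpr (NeZero.ne _)
  have hnpp : IsPrimePow (p ^ (k + 1)) := hp.isPrimePow.pow (Nat.succ_ne_zero k)
  have hdiv : ∀ P : geomPoints V, ∃ Q : geomPoints V, ((p ^ (k + 1) : ℕ) : ℤ) • Q = P :=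
    fun P => V.zsmul_geomPoints_surjective_holds hn0 P
  obtain ⟨hidx0, -, -⟩ := relIndex_selmerGroup_kummerOutside_mul_addOrderOf_le V (p ^ (k + 1)) v hnpp hdiv 0
  haveI hSel : Finite (selmerGroup V ((p ^ (k + 1) : ℕ) : ℤ)) := V.finite_selmerGroup_holds hn0
  set KO := kummerOutside V (p ^ (k + 1)) {Sum.inr v}
  set Sel := selmerGroup V ((p ^ (k + 1) : ℕ) : ℤ)
  have hle : Sel ≤ KO := selmerGroup_le_kummerOutside V (p ^ (k + 1)) _
  -- `#KO = [KO : Sel] · #Sel ≠ 0`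
  have hcard : Nat.card KO = Nat.card (KO ⧸ Sel.addSubgroupOf KO) * Nat.card (Sel.addSubgroupOf KO) :=
    AddSubgroup.card_eq_card_quotient_mul_card_addSubgroup _
  have h1 : Nat.card (KO ⧸ Sel.addSubgroupOf KO) ≠ 0 := hidx0
  have h2 : Nat.card (Sel.addSubgroupOf KO) ≠ 0 := by
    rw [Nat.card_congr (AddSubgroup.addSubgroupOfEquivOfLe hle).toEquiv]
    exact Nat.card_pos.ne'
  exact Nat.finite_of_card_ne_zero (by rw [hcard]; exact mul_ne_zero h1 h2)

end Levels

/-! ## §2. The finiteness theorem -/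

section Finite

variable {K : Type} [Field K] [NumberField K] (V : WeierstrassCurve K) [V.IsElliptic] (p : ℕ) [Fact p.Prime]
  (π : V.endRing) (r r' : ℤ_[p])
  (f₀ : V.geomPoints →+ V.geomPoints) (hf₀ : ∀ (σ : absoluteGaloisGroup K) (P : V.geomPoints), f₀ (σ • P) = σ • f₀ P)
  (hfr : ∀ (k : ℕ) (N : ℤ) (x : V.geomPrimaryTorsion p), x ∈ V.endEigenPrimaryTorsion p π r → p ^ k • x = 0 →
    ((N : ℤ_[p]) - r) ∈ (Ideal.span {(p : ℤ_[p]) ^ k} : Ideal ℤ_[p]) → f₀ (x : V.geomPoints) = N • (x : V.geomPoints))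
  (hfr' : ∀ (k : ℕ) (N : ℤ) (x : V.geomPrimaryTorsion p), x ∈ V.endEigenPrimaryTorsion p π r' → p ^ k • x = 0 →
    ((N : ℤ_[p]) - r') ∈ (Ideal.span {(p : ℤ_[p]) ^ k} : Ideal ℤ_[p]) → f₀ (x : V.geomPoints) = N • (x : V.geomPoints))
  (hunit : IsUnit (r - r')) (hloc : HasLocalPointsMaps V V f₀)
  (e : V.geomPrimaryTorsion p →+ ↥(V.endEigenPrimaryTorsion p π r))
  (e' : V.geomPrimaryTorsion p →+ ↥(V.endEigenPrimaryTorsion p π r'))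
  (he : ∀ (σ : absoluteGaloisGroup K) (x : V.geomPrimaryTorsion p), e (σ • x) = σ • e x)
  (he' : ∀ (σ : absoluteGaloisGroup K) (x : V.geomPrimaryTorsion p), e' (σ • x) = σ • e' x)
  (hsum : ∀ x, (e x : V.geomPrimaryTorsion p) + (e' x : V.geomPrimaryTorsion p) = x)

include hf₀ hfr hfr' hunit hloc he he' hsum in
/-- **`𝔖_{v̄}(K, W*)` IS FINITE from (U) a uniform relaxation exponent at `v`, (Ш) `Ш(E_K/K)[p^∞]` finite, and (Q) the strict-at-`v̄`
Mordell–Weil classes of the summand finite** (`K` totally complex, `v ≠ v̄` the places above `p`; `e ∘ ι = id`; `f₀` as in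
`resH1Hom_subtype_proj_mem_map_resSubgroup_selmer`). See the module docstring for the four steps. This is the abstract form of
Agboola's «`𝔖_{𝔭*}(K, W*)` is finite when `Ш(K)` is finite and `r = 1`» (§6) — the rank input sits in (U), the CM pinning in (Q).
[cite: Agboola2007, §6 Props. 6.10–6.12 (arXiv p0014–p0015)] [cite: GreenbergLNM1716, §2 p. 63 and §5 proof of Prop. 5.8]
[cite: MilneADT2006, I Thm. 4.10(b)] [cite: SilvermanAEC2009, Thm. X.4.2(b)] -/
theorem finite_restrictedSelmerBase_of_uniform_of_finite [IsTotallyComplex K]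
    (he₁ : ∀ x : ↥(V.endEigenPrimaryTorsion p π r), e x = x)
    {v vbar : HeightOneSpectrum (𝓞 K)} (hall : ∀ w : HeightOneSpectrum (𝓞 K), ((p : ℕ) : 𝓞 K) ∈ w.asIdeal → w = v ∨ w = vbar)
    (hU : ∃ N : ℕ, N ≠ 0 ∧ ∀ (k : ℕ) (c : galH1Torsion V ((p ^ (k + 1) : ℕ) : ℤ)),
      c ∈ kummerOutside V (p ^ (k + 1)) {Sum.inr v} → N • c ∈ selmerGroup V ((p ^ (k + 1) : ℕ) : ℤ))
    [hsha : Finite (AddCommGroup.primaryComponent V.sha p)]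
    (hQ : Finite ↥((((V.kummerMapPInfty p V.zsmul_geomPoints_surjective_holds).range).map
        (resSubgroup ⊤ (V.geomPrimaryTorsion p))).comap
          (resH1Hom (ContinuousMonoidHom.id _) (V.endEigenPrimaryTorsion p π r).subtype (fun _ _ ↦ rfl)) ⊓
        (resOfLe ↥(V.endEigenPrimaryTorsion p π r) (@inf_le_left _ _ (⊤ : Subgroup (absoluteGaloisGroup K)) (decomp vbar))).ker)) :
    Finite (restrictedSelmerBase ↥(V.endEigenPrimaryTorsion p π r) p vbar) := by
  have hp : p.Prime := Fact.out
  obtain ⟨N, hN0, hN⟩ := hU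
  have hM : ∀ m : V.geomPrimaryTorsion p, IsOpen {σ : absoluteGaloisGroup K | σ • m = m} := isOpen_stabilizer_geomPrimaryTorsion V p
  -- notation
  set 𝔖 := restrictedSelmerBase ↥(V.endEigenPrimaryTorsion p π r) p vbar with h𝔖
  set R := resSubgroup (⊤ : Subgroup (absoluteGaloisGroup K)) (V.geomPrimaryTorsion p) with hR
  set j : subgroupH1 (⊤ : Subgroup (absoluteGaloisGroup K)) ↥(V.endEigenPrimaryTorsion p π r) →+
      subgroupH1 (⊤ : Subgroup (absoluteGaloisGroup K)) (V.geomPrimaryTorsion p) :=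
    resH1Hom (ContinuousMonoidHom.id _) (V.endEigenPrimaryTorsion p π r).subtype (fun _ _ ↦ rfl) with hj
  set Q₀ := ((V.kummerMapPInfty p V.zsmul_geomPoints_surjective_holds).range).map R with hQ₀
  set SelR := (V.selmerGroupPInfty p).map R with hSelR
  set 𝔖Sel := 𝔖 ⊓ SelR.comap j with h𝔖Sel
  -- the level lift at level `p^k`
  have hΦ : ∀ (k : ℕ) (x : galoisCohomology (V.torsionGaloisModule ((p ^ k : ℕ) : ℤ)) 1),
      resH1Hom (Literature.NumberTheory.EllipticCurves.subgroupIncl (⊤ : Subgroup (absoluteGaloisGroup K)))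
          (AddMonoidHom.id ↥(V.endEigenPrimaryTorsion p π r)) (fun _ _ ↦ rfl)
          (resH1Hom (ContinuousMonoidHom.id (absoluteGaloisGroup K)) e (fun σ m ↦ he σ m)
            (toDiscreteH1 hM (galoisCohomology.map (primaryInclusion V p k) 1 x))) =
        resH1Hom (ContinuousMonoidHom.id _) e (fun σ m ↦ by rw [Subgroup.smul_def, Subgroup.smul_def]; exact he σ m)
          (R (toDiscreteH1 hM (galoisCohomology.map (primaryInclusion V p k) 1 x))) := by
    intro k x
    have h := resSubgroup_resH1Hom_proj V p π r e he ⊤ (toDiscreteH1 hM (galoisCohomology.map (primaryInclusion V p k) 1 x))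
    exact h
  -- every class of `H¹(⊤, W*)` is `p`-primary
  have hprim : ∀ y : subgroupH1 (⊤ : Subgroup (absoluteGaloisGroup K)) ↥(V.endEigenPrimaryTorsion p π r), ∃ m : ℕ, p ^ m • y = 0 := by
    intro y
    haveI : CompactSpace (absoluteGaloisGroup K) := compactSpace_absoluteGaloisGroup K
    have hcl : IsClosed (((⊤ : Subgroup (absoluteGaloisGroup K)) : Set (absoluteGaloisGroup K))) := by
      rw [Subgroup.coe_top]; exact isClosed_univ
    refine exists_pow_nsmul_eq_zero_subgroupH1 (N := (⊤ : Subgroup (absoluteGaloisGroup K))) (M := ↥(V.endEigenPrimaryTorsion p π r))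
      hcl (p := p) ?_ y
    intro m
    obtain ⟨k, hk⟩ := (AddCommGroup.mem_primaryComponent).mp (m : V.geomPrimaryTorsion p).2
    exact ⟨k, Subtype.ext (Subtype.ext (by
      rw [AddSubmonoidClass.coe_nsmul, AddSubmonoidClass.coe_nsmul, hk, ZeroMemClass.coe_zero, ZeroMemClass.coe_zero]))⟩
  -- classes of `𝔖` are strict at `v̄`
  have hstrict : ∀ c ∈ 𝔖, resOfLe ↥(V.endEigenPrimaryTorsion p π r) (inf_le_left : (⊤ : Subgroup (absoluteGaloisGroup K)) ⊓ decomp vbar ≤ ⊤) c = 0 := by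
    intro c hc
    have h := ((mem_restrictedSelmer_iff_resOfLe (⊤ : Subgroup (absoluteGaloisGroup K)) ↥(V.endEigenPrimaryTorsion p π r) p vbar c).mp hc).2.2 1
    rwa [conjH1_of_mem_holds (⊤ : Subgroup (absoluteGaloisGroup K)) ↥(V.endEigenPrimaryTorsion p π r) (Subgroup.mem_top _),
      AddMonoidHom.id_apply] at h
  -- STEP 1: `N • 𝔖 ⊆ 𝔖_Sel`
  have hstep1 : ∀ y ∈ 𝔖, N • y ∈ 𝔖Sel := by
    intro y hy
    obtain ⟨m, hm⟩ := hprim y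
    haveI : NeZero (p ^ (m + 1)) := ⟨pow_ne_zero _ hp.ne_zero⟩
    have hm' : p ^ (m + 1) • y = 0 := by rw [pow_succ, mul_comm, mul_smul, hm, smul_zero]
    obtain ⟨x, hx, hxy⟩ := exists_mem_kummerOutside_levelLift_eq V p π r (m + 1) e he he₁ hall hy hm'
    refine AddSubgroup.mem_inf.mpr ⟨AddSubgroup.nsmul_mem _ hy N, ?_⟩
    rw [AddSubgroup.mem_comap]
    -- `N • y = Φ (N • x)` and `ι_* (N • x) ∈ Sel_{p^∞}`
    have hNx : N • x ∈ selmerGroup V ((p ^ (m + 1) : ℕ) : ℤ) := hN m x hx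
    have hz : galoisCohomology.map (primaryInclusion V p (m + 1)) 1 (N • x) ∈ V.selmerGroupPInfty p :=
      map_primaryInclusion_mem_selmerGroupPInfty V p (m + 1) hNx
    set Φ : galoisCohomology (V.torsionGaloisModule ((p ^ (m + 1) : ℕ) : ℤ)) 1 →+
        subgroupH1 (⊤ : Subgroup (absoluteGaloisGroup K)) ↥(V.endEigenPrimaryTorsion p π r) :=
      ((resH1Hom (Literature.NumberTheory.EllipticCurves.subgroupIncl (⊤ : Subgroup (absoluteGaloisGroup K)))
          (AddMonoidHom.id ↥(V.endEigenPrimaryTorsion p π r)) (fun _ _ ↦ rfl)).comp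
        (resH1Hom (ContinuousMonoidHom.id (absoluteGaloisGroup K)) e (fun σ m ↦ he σ m))).comp
        ((toDiscreteH1 hM).toAddMonoidHom.comp (galoisCohomology.map (primaryInclusion V p (m + 1)) 1)) with hΦdef
    have hΦapply : ∀ x', Φ x' = resH1Hom (Literature.NumberTheory.EllipticCurves.subgroupIncl (⊤ : Subgroup (absoluteGaloisGroup K)))
        (AddMonoidHom.id ↥(V.endEigenPrimaryTorsion p π r)) (fun _ _ ↦ rfl)
        (resH1Hom (ContinuousMonoidHom.id (absoluteGaloisGroup K)) e (fun σ m ↦ he σ m)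
          (toDiscreteH1 hM (galoisCohomology.map (primaryInclusion V p (m + 1)) 1 x'))) := fun _ ↦ rfl
    have hNy : N • y = resH1Hom (ContinuousMonoidHom.id _) e (fun σ m ↦ by rw [Subgroup.smul_def, Subgroup.smul_def]; exact he σ m)
        (R (toDiscreteH1 hM (galoisCohomology.map (primaryInclusion V p (m + 1)) 1 (N • x)))) := by
      rw [← hΦ, ← hΦapply, map_nsmul, hΦapply, hxy]
    rw [hNy]
    have hsel := resH1Hom_subtype_proj_mem_map_resSubgroup_selmer V p π r r' f₀ hf₀ hfr hfr' hunit hloc e e' he he' hsum hz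
    exact hsel
  -- STEP 2: `𝔖_Sel` is finite (kernel ≤ (Q), range ≤ Ш[p^∞])
  have hfinSel : Finite 𝔖Sel := by
    set Re := AddEquiv.ofBijective R (resSubgroup_top_bijective (V.geomPrimaryTorsion p)) with hRe
    set fS : 𝔖Sel →+ V.galH1 := ((V.primaryH1ToH1 p).comp Re.symm.toAddMonoidHom).comp (j.comp 𝔖Sel.subtype) with hfS
    have hker : fS.ker = (Q₀.comap j).addSubgroupOf 𝔖Sel := ker_shaMap_eq V p π r 𝔖Sel
    -- kernel injects into the group of (Q)
    have hkerfin : Finite fS.ker := by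
      rw [hker]
      refine Finite.of_injective (fun c : (Q₀.comap j).addSubgroupOf 𝔖Sel ↦
        (⟨((c : 𝔖Sel) : subgroupH1 ⊤ ↥(V.endEigenPrimaryTorsion p π r)), ?_⟩ :
          ↥((Q₀.comap j) ⊓ (resOfLe ↥(V.endEigenPrimaryTorsion p π r) (@inf_le_left _ _ (⊤ : Subgroup (absoluteGaloisGroup K)) (decomp vbar))).ker))) ?_
      · refine AddSubgroup.mem_inf.mpr ⟨AddSubgroup.mem_addSubgroupOf.mp c.2, ?_⟩
        have hc𝔖 : ((c : 𝔖Sel) : subgroupH1 ⊤ ↥(V.endEigenPrimaryTorsion p π r)) ∈ 𝔖 := (AddSubgroup.mem_inf.mp (c : 𝔖Sel).2).1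
        exact (AddMonoidHom.mem_ker).mpr (hstrict _ hc𝔖)
      · intro c c' h
        have h' := congrArg Subtype.val h
        exact Subtype.ext (Subtype.ext h')
    -- range inside `Ш[p^∞]`
    have hval : ∀ c : 𝔖Sel, ∃ z ∈ V.selmerGroupPInfty p, fS c = V.primaryH1ToH1 p z := by
      intro c
      have hcSel : ((c : subgroupH1 ⊤ ↥(V.endEigenPrimaryTorsion p π r))) ∈ SelR.comap j := (AddSubgroup.mem_inf.mp c.2).2
      rw [AddSubgroup.mem_comap] at hcSel
      obtain ⟨z, hz, hzc⟩ := AddSubgroup.mem_map.mp hcSel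
      have hRez : Re.symm (j (c : subgroupH1 ⊤ ↥(V.endEigenPrimaryTorsion p π r))) = z := by
        rw [← hzc]; exact Re.symm_apply_apply z
      refine ⟨z, hz, ?_⟩
      simp only [hfS, AddMonoidHom.comp_apply, AddSubgroup.coe_subtype, AddEquiv.coe_toAddMonoidHom]
      rw [hRez]
    have hsha_mem : ∀ c : 𝔖Sel, fS c ∈ V.sha := by
      intro c
      obtain ⟨z, hz, hzc⟩ := hval c
      rw [hzc]
      rw [V.selmerGroupPInfty_eq_comap_sha p] at hz
      exact hz
    let f1 : 𝔖Sel →+ V.sha := fS.codRestrict V.sha hsha_mem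
    have hprimary : ∀ c : 𝔖Sel, f1 c ∈ AddCommGroup.primaryComponent V.sha p := by
      intro c
      obtain ⟨z, -, hzc⟩ := hval c
      obtain ⟨J, hJ⟩ := exists_pow_smul_galH1Primary_eq_zero V p z
      refine (AddCommGroup.mem_primaryComponent).mpr ⟨J, ?_⟩
      apply Subtype.ext
      change p ^ J • fS c = 0
      rw [hzc, ← map_nsmul, hJ, map_zero]
    -- range finite, kernel finite ⟹ domain finite
    let g : 𝔖Sel →+ AddCommGroup.primaryComponent V.sha p := f1.codRestrict _ hprimary
    have hgker : g.ker = fS.ker := by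
      ext c
      rw [AddMonoidHom.mem_ker, AddMonoidHom.mem_ker]
      constructor
      · intro h
        have h1 := congrArg (fun t : AddCommGroup.primaryComponent V.sha p ↦ (((t : V.sha)) : V.galH1)) h
        exact h1
      · intro h
        apply Subtype.ext; apply Subtype.ext
        exact h
    haveI : Finite g.ker := by rw [hgker]; exact hkerfin
    haveI : Finite g.range := inferInstance
    have hmul : Nat.card 𝔖Sel = Nat.card g.range * Nat.card g.ker := by
      rw [AddSubgroup.card_eq_card_quotient_mul_card_addSubgroup g.ker, Nat.card_congr (QuotientAddGroup.quotientKerEquivRange g).toEquiv]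
    exact Nat.finite_of_card_ne_zero (by rw [hmul]; exact mul_ne_zero Nat.card_pos.ne' Nat.card_pos.ne')
  -- STEP 3: `𝔖[N]` is finite
  set a : ℕ := padicValNat p N with ha
  haveI : NeZero (p ^ (a + 1)) := ⟨pow_ne_zero _ hp.ne_zero⟩
  haveI hKOfin : Finite (kummerOutside V (p ^ (a + 1)) {Sum.inr v}) := finite_kummerOutside V p a v
  -- the level lift at level `p^(a+1)` as a function on `kummerOutside`
  let Φa : kummerOutside V (p ^ (a + 1)) {Sum.inr v} → subgroupH1 (⊤ : Subgroup (absoluteGaloisGroup K)) ↥(V.endEigenPrimaryTorsion p π r) :=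
    fun x ↦ resH1Hom (Literature.NumberTheory.EllipticCurves.subgroupIncl (⊤ : Subgroup (absoluteGaloisGroup K)))
      (AddMonoidHom.id ↥(V.endEigenPrimaryTorsion p π r)) (fun _ _ ↦ rfl)
      (resH1Hom (ContinuousMonoidHom.id (absoluteGaloisGroup K)) e (fun σ m ↦ he σ m)
        (toDiscreteH1 hM (galoisCohomology.map (primaryInclusion V p (a + 1)) 1 (x : galoisCohomology _ 1))))
  have htors : ∀ y ∈ 𝔖, N • y = 0 → y ∈ Set.range Φa := by
    intro y hy hNy
    -- `y` has order a power of `p` dividing `N`, hence dividing `p^a`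
    obtain ⟨m, hm⟩ := hprim y
    have hdvdN : addOrderOf y ∣ N := addOrderOf_dvd_of_nsmul_eq_zero hNy
    have hdvdp : addOrderOf y ∣ p ^ m := addOrderOf_dvd_of_nsmul_eq_zero hm
    obtain ⟨i, -, hi⟩ := (Nat.dvd_prime_pow hp).mp hdvdp
    have hia : i ≤ a := by
      rw [ha]
      have h : p ^ i ∣ N := hi ▸ hdvdN
      exact (padicValNat_dvd_iff_le hN0).mp h
    have hay : p ^ (a + 1) • y = 0 := by
      have h1 : p ^ i • y = 0 := by rw [← hi]; exact addOrderOf_nsmul_eq_zero y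
      obtain ⟨d, hd⟩ : ∃ d, a + 1 = i + d := ⟨a + 1 - i, by omega⟩
      rw [hd, pow_add, mul_comm, mul_smul, h1, smul_zero]
    obtain ⟨x, hx, hxy⟩ := exists_mem_kummerOutside_levelLift_eq V p π r (a + 1) e he he₁ hall hy hay
    exact ⟨⟨x, hx⟩, hxy⟩
  -- STEP 4: `𝔖 → 𝔖_Sel`, `y ↦ N • y`, has finite kernel and finite codomain
  haveI := hfinSel
  let μ : 𝔖 →+ 𝔖Sel := ((nsmulAddMonoidHom N).comp 𝔖.subtype).codRestrict 𝔖Sel (fun y ↦ hstep1 y y.2)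
  have hμker : Finite μ.ker := by
    let ev : μ.ker → subgroupH1 (⊤ : Subgroup (absoluteGaloisGroup K)) ↥(V.endEigenPrimaryTorsion p π r) := fun c ↦ c.1.1
    have hsub : Set.range ev ⊆ Set.range Φa := by
      rintro _ ⟨c, rfl⟩
      have hc0 : μ c.1 = 0 := (AddMonoidHom.mem_ker).mp c.2
      have hN' : N • (c.1.1 : subgroupH1 ⊤ ↥(V.endEigenPrimaryTorsion p π r)) = 0 := by
        have := congrArg Subtype.val hc0
        exact this
      exact htors c.1.1 c.1.2 hN'
    have hfinr : (Set.range Φa).Finite := Set.finite_range Φa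
    have hinj : Function.Injective ev := fun c c' h ↦ Subtype.ext (Subtype.ext h)
    haveI : Finite (Set.range ev) := (hfinr.subset hsub).to_subtype
    let ev' : μ.ker → Set.range ev := fun c ↦ ⟨ev c, ⟨c, rfl⟩⟩
    have hinj' : Function.Injective ev' := fun c c' h ↦ by
      apply hinj
      have h1 := congrArg (fun t : Set.range ev ↦ (t : subgroupH1 (⊤ : Subgroup (absoluteGaloisGroup K)) ↥(V.endEigenPrimaryTorsion p π r))) h
      exact h1
    exact Finite.of_injective ev' hinj'
  haveI : Finite μ.range := inferInstance
  have hmul : Nat.card 𝔖 = Nat.card μ.range * Nat.card μ.ker := by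
    rw [AddSubgroup.card_eq_card_quotient_mul_card_addSubgroup μ.ker, Nat.card_congr (QuotientAddGroup.quotientKerEquivRange μ).toEquiv]
  haveI := hμker
  exact Nat.finite_of_card_ne_zero (by rw [hmul]; exact mul_ne_zero Nat.card_pos.ne' Nat.card_pos.ne')

end Finite

end Summit.BirchSwinnertonDyer.BirchSwinnertonDyer.Theorems.PrintCf2.RelaxationLift

end
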